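import Literature.Analysis.FluidPDE.Ferrari1993Prop1LogEstimate
import Literature.Analysis.FluidPDE.PeriodicCylinderLogDivCurl
import HarnessLib

/-!
# Ferrari's global `δ`-estimate (71) in the periodic cylinder is equivalent to her
Proposition 1 (review record of the merged fact `Ferrari1993_periodicCylinderVorticityH2DeltaLogEstimate`)

Topic `Literature/Analysis/FluidPDE`. **Everything here is proved; the file declares no
definition and no named fact.**

In the proof of Proposition 1 of A. B. Ferrari, *On the blow-up of solutions of the 3-D Euler
equations in a bounded domain*, Comm. Math. Phys. **155** (1993) — (30) p. 286: for `Ω ⊂ ℝ³`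
bounded, simply connected, of class `C^{2+β}` and `v ∈ H³(Ω)` solving (22) with data `φ ∈ H²(Ω)`,
`χ = 0` (i.e. `curl v = φ`, `div v = 0` in `Ω`, `v·n = 0` on `∂Ω`),
`|v|_{W^{1,∞}(Ω)} ≤ C (1 + log⁺(‖φ‖_{H²(Ω)}/‖φ‖_{L^∞(Ω)})) ‖φ‖_{L^∞(Ω)}` — the interior estimate
(50) p. 289 and the boundary estimate (70) p. 292 combine into the **global `δ`-estimate (71)**
p. 292, `|D_k v|_{L^∞(Ω)} ≤ (C₁ − C₂ log δ) |φ|_{L^∞(Ω)} + C δ^{1/2} ‖φ‖_{H²(Ω)}` for `δ ≤ ε(Ω)`,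
and "the proof of the proposition is completed by setting `δ = min{(|φ|_{L^∞}/‖φ‖_{H²(Ω)})², ε}`"
((72) p. 293). In the rendering of this chain (below) the two statements read, for `L > 0` and a
constant `C`, for every velocity field `v` of class `C^∞` on the closed cylinder `{r ≤ 1}`,
`L`-periodic in `z`, divergence free in `{r < 1}` and tangential on `{r = 1}`, and all upper
bounds `N ≥ ‖curl v‖_{H²(cell)}`, `e ≥ ‖v‖_{L²(cell)}`, `A ≥ sup_{r<1} |curl v|`:

* (71): `‖Dv(x)‖ ≤ C (e + (1 + log(1/δ)) A + δ^{1/2} N)` on `{r < 1}` for every `0 < δ ≤ 1`;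
* (30): `‖Dv(x)‖ ≤ C (e + 1 + (1 + log⁺ N) A)` on `{r < 1}`.

This file proves that they are **equivalent**, with explicit constants, and records what they
imply:

* `Ferrari1993_periodicCylinderVorticityH2LogEstimate_of_deltaFamily` — (71) with constant `C`
  gives (30) with constant `2C`: the printed choice of the radius, here `δ = max(1, N)^{-2}`, for
  which `log(1/δ) = 2 log⁺ N` and `δ^{1/2} N ≤ 1`;
* `periodicCylinderVorticityH2DeltaLogEstimate_of_vorticityH2LogEstimate` — (30) with constant
  `C` gives (71) with the *same* constant, by **scaling**: the admissible class is a cone and the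
  four sizes `‖Dv(x)‖`, `‖curl v‖_{H²(cell)}`, `‖v‖_{L²(cell)}`, `sup |curl v|` are positively
  homogeneous of degree one (`fderiv_const_smul`, `curl_const_smul` with
  `eSobolevDomainNorm_const_smul_le`, `eLpNorm_const_smul`), so (30) for `c • v`, `c > 0`, divided
  by `c` reads `‖Dv(x)‖ ≤ C (e + c⁻¹ + (1 + log⁺(c N)) A)`
  (`norm_fderiv_le_of_vorticityH2LogBound_smul`); for `N > 0` take `c = (δ^{1/2} N)⁻¹`, so that
  `c⁻¹ = δ^{1/2} N` and `log⁺(c N) = log⁺(δ^{-1/2}) = ½ log(1/δ)`, and for `N = 0` let `c → ∞` —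
  the argument by which `PeriodicCylinderLogDivCurl.lean` proves the Shirota–Yanagisawa form of the
  `δ`-family equivalent to `ShirotaYanagisawa1993_periodicCylinderLogDivCurlEstimate`;
* `periodicCylinderVorticityH2LogEstimate_iff_deltaLogEstimate` — the equivalence (30) ↔ (71);
* `ShirotaYanagisawa1993_periodicCylinderDeltaLogDivCurlEstimate_of_vorticityH2DeltaFamily` — (71)
  gives the Shirota–Yanagisawa form of the `δ`-family (near-field term `δ^{1/2} n`,
  `n ≥ ‖v‖_{H³(cell)}`; Shirota–Yanagisawa 1993, (21) p. 81) by `‖curl v‖_{H²(cell)} ≤ C_S ‖v‖_{H³(cell)}`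
  (`exists_eSobolevDomainNorm_curl_le`; "(31) follows easily from (30)", Proof of Corollary p. 286);
* `ShirotaYanagisawa1993_periodicCylinderLogDivCurlEstimate_of_deltaLogEstimate` — (71) gives the
  chain's remaining leaf `ShirotaYanagisawa1993_periodicCylinderLogDivCurlEstimate` (Cor. 1 (31)
  read for one field), through (30) and `ShirotaYanagisawa1993_periodicCylinderLogDivCurlEstimate_of_vorticityH2`
  (`Ferrari1993Prop1LogEstimate.lean`).

## Review record (D-0026): the named fact `Ferrari1993_periodicCylinderVorticityH2DeltaLogEstimate` is merged back

The rendering of (71) first landed in this file as the named fact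
`Ferrari1993_periodicCylinderVorticityH2DeltaLogEstimate`, minted — together with a Green-matrix
fact below it, since merged back (`PeriodicCylinderGreenMatrix.lean`) — as the decomposition of
`Ferrari1993_periodicCylinderVorticityH2LogEstimate` (Prop. 1 (30) in the periodic cylinder),
itself the first decomposition child of `ShirotaYanagisawa1993_periodicCylinderLogEstimate` and
since merged back (`Ferrari1993Prop1LogEstimate.lean`). The prove seat of (71) triaged it XL and
asked for a further split; decompositions do not recurse. The split review, with Ferrari
pp. 283–293 open (held text, (71) p. 292, (72) p. 293, (30)–(31) p. 286, Thms 3–4 p. 285), found: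

* the statement is **faithful** to (71) (rendering and adaptation caveat below, those of the
  accepted docstring, confirmed by the review of the minting proposal) and is **neither open nor
  misstated**;
* it is **not provable inline**: the printed proof is the potential theory of the system (22) up
  to the boundary — Thm 4 p. 285, "a specialization of Theorem 1.1 of [11]" (Solonnikov's Green
  matrix with `|D^β 𝒢(x, y)| ≤ C|x − y|^{-2-|β|}`, used as (33)–(34)), and Thm 3 p. 285, "a
  specialization of Theorem 10.5 of [3]" (the Agmon–Douglis–Nirenberg `W^{1,p}` estimate, used in
  (47), (62)–(63), (68) and on p. 293) —, absent from Mathlib and from the tree;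
* as a decomposition child it is **mis-cut**: it is its parent reworded — (71) and (30) are
  *equivalent* in this rendering, by the choice of `δ` one way (fifty lines) and by scaling the
  other (this file), with constants `C ↦ 2C`, `C ↦ C` —, it is XL like the parent, and it is
  strictly stronger than what the chain consumes: every dependent
  (`Ferrari1993ContinuationLeaves.lean`) went through (30) ⇒ (31), i.e. used only
  `ShirotaYanagisawa1993_periodicCylinderLogDivCurlEstimate`, which is Cor. 1 with `‖v‖_{H³}` in
  place of Prop. 1's `‖curl v‖_{H²}` and which `PeriodicCylinderLogDivCurl.lean` proves equivalent
  to its own `δ`-family. No distinct, M-sized published result separates (71) from (30) or from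
  (31).

It was therefore **merged back**: the `def` is deleted; its body, unchanged, is the written-out
hypothesis `hD` of `Ferrari1993_periodicCylinderVorticityH2LogEstimate_of_deltaFamily`,
`ShirotaYanagisawa1993_periodicCylinderDeltaLogDivCurlEstimate_of_vorticityH2DeltaFamily` (names and
proofs unchanged) and `ShirotaYanagisawa1993_periodicCylinderLogDivCurlEstimate_of_deltaLogEstimate`
(moved here from `Ferrari1993ContinuationLeaves.lean`, whose end-to-end assemblies now take
`ShirotaYanagisawa1993_periodicCylinderLogDivCurlEstimate` itself), and the written-out conclusion
of the converse added here. Nothing is weakened, no statement of the chain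
`ShirotaYanagisawa1993_periodicCylinderLogDivCurlEstimate → ShirotaYanagisawa1993_periodicCylinderLogEstimate
→ Ferrari1993_periodicCylinderH3Bound → Ferrari1993_periodicCylinderContinuation →
Ferrari1993_periodicCylinderEulerBKM` changes, and its trust base shrinks to the single stationary
estimate `ShirotaYanagisawa1993_periodicCylinderLogDivCurlEstimate` (with
`KatoLai1984_periodicCylinderUniformExistence` for the continuation theorem): net debt −1.

## Faithfulness of the written-out statements / what is NOT here

* (71) (hypothesis `hD`, conclusion of the converse) is read in the periodic cylinder with the
  field hypotheses of the whole chain (those of `ShirotaYanagisawa1993_periodicCylinderLogDivCurlEstimate`: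
  fields `C^∞` on the closed cylinder `{r ≤ 1}` — smoother than the printed `v ∈ H³`, `φ ∈ H²` —,
  `L`-periodic in `z`, divergence free in `{r < 1}`, tangential on `{r = 1}`; `|D_k v|_{L^∞}` as
  the supremum over `{r < 1}` of the operator norm of the classical derivative; `‖φ‖_{H²(Ω)}` by
  the tree's `eSobolevDomainNorm 2 2 (cylinderCell L) volume (curl v)`; the sizes enter as upper
  bounds `N, e, A`, the right-hand side being monotone in them for `δ ≤ 1`). Against the print:
  Ferrari restricts to `δ ≤ ε(Ω)`; for `ε < δ ≤ 1` the bound at radius `ε` is at most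
  `max(1, 1 + log(1/ε))` times ours, absorbed in `C`, so all `0 < δ ≤ 1` are allowed;
  `(C₁ − C₂ log δ)` is written `C(1 + log(1/δ))`. Ferrari's `Ω` is simply connected, so (22) has no
  harmonic solutions and no `L²` term occurs; the periodic cylinder `{r ≤ 1} × ℝ/Lℤ` is a compact
  flat manifold with boundary whose harmonic fields (divergence free, curl free, tangential,
  periodic) are the multiples of `e_z`, of zero gradient, and Shirota–Yanagisawa, who treat
  general topology, bound the harmonic components by `‖u‖₀` ((17) p. 80) — whence the term
  `e ≥ ‖v‖_{L²(cell)}`, as in every fact of this chain (adaptation caveat of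
  `Ferrari1993_periodicCylinderH3Bound`; Luo–Hou 2014 §4.4, Chen–Hou 2021 §9 use the estimate in
  this geometry).
* (30) (conclusion of `…_of_deltaFamily`, hypothesis `hP` of the converse and of
  `ShirotaYanagisawa1993_periodicCylinderLogDivCurlEstimate_of_vorticityH2`) is rendered in the
  "+1" normalisation of Cor. 1 / Shirota–Yanagisawa (15), `C (e + 1 + (1 + log⁺ N) A)`, which the
  printed scale-invariant form `C (1 + log⁺(‖φ‖_{H²}/‖φ‖_{L^∞})) ‖φ‖_{L^∞}` implies
  (`A log⁺(N/A) ≤ A log⁺ N + e⁻¹`) and which avoids the quotient; the `L^∞` part of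
  `|v|_{W^{1,∞}}` is dropped (recovered downstream from the energy,
  `norm_le_of_eLpNorm_two_le_of_norm_fderiv_le`).
* Not here: any named fact; the discharge of `ShirotaYanagisawa1993_periodicCylinderLogDivCurlEstimate`
  (equivalently, by this file and `Ferrari1993Prop1LogEstimate.lean`, a proof of (71) or of (30)
  in the periodic cylinder). For its prover the tree holds: the whole-space kernel computations of
  (37) and (48) (`NewtonKernelLogPotential.lean`), the Hölder step `[curl v]_{C^{0,1/2}} ≤ C ‖v‖_{H³(cell)}`
  (`PeriodicCylinderSobolevHolder.lean`), the Sobolev inequalities, Gauss–Green identities and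
  wall trace on the cell (`PeriodicCylinderSobolevInequalities.lean`, `PeriodicCylinderGaussGreen.lean`,
  `PeriodicCylinderWallFlux.lean`, `PeriodicCylinderWallTrace.lean`), the Hölder theory of the
  Newtonian potential (`NewtonNearGradPotential.lean`, `HolderCZKernel.lean`, Gilbarg–Trudinger
  Lemma 4.2 / Majda–Bertozzi Lemma 4.6), and the hypothesis-form Green-matrix predicate
  `IsPeriodicCylinderGreenMatrix` with the printed derivation plan (`PeriodicCylinderGreenMatrix.lean`).
  The review also notes, without vouching for its size, a route special to the round cylinder
  which imports no boundary potential theory: reflect the field across the wall in cylindrical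
  components, `ṽ_r(r) = −(r*/r) v_r(r*)`, `ṽ_θ(r) = v_θ(r*)`, `ṽ_z(r) = (r*/r) v_z(r*)`, `r* = 2 − r`,
  for which `div ṽ = (r*/r)(div v)(r*)` exactly and `curl ṽ` is the reflected vorticity plus terms
  `O(1)·v(r*) + O(r − 1)·∂_θ v(r*)`; the cut-off extension is continuous across the wall, so it is
  represented by the whole-space Biot–Savart law, and the wall integrals
  `∫_{r=1} η(|x − y|) ∇Γ(x − y) ⊗ e_r dθ dz` produced by freezing the density at the wall are
  bounded uniformly in `x` by the symmetries `θ − θ_x ↦ −(θ − θ_x)`, `z − z_x ↦ −(z − z_x)` of the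
  cylinder (the odd components vanish, the even ones are `O(|x − y|^{-1})` or of Poisson type); the
  error terms carry the factor `r − 1 ≤ |x − y|` or the thin collar and are absorbed.

Tree search: `lean search 'VorticityH2|DeltaLogEstimate'` — this file, `Ferrari1993Prop1LogEstimate.lean`
and docstring mentions only. Used: `exists_eSobolevDomainNorm_curl_le`,
`ShirotaYanagisawa1993_periodicCylinderLogDivCurlEstimate_of_vorticityH2` (`Ferrari1993Prop1LogEstimate`);
`eSobolevDomainNorm_const_smul_le` (`PeriodicCylinderLogDivCurl`); `curl_const_smul`
(`VorticityCalculus`); `SobolevApprox.eSobolevDomainNorm_congr`, `cylinderCell_le_unitCylinder`,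
`closure_unitCylinder_mem_nhds`; Mathlib `Real.posLog_eq_log_max_one`, `Real.posLog_eq_log`,
`Real.log_rpow`, `Real.log_pow`, `Real.sqrt_eq_rpow`, `eLpNorm_const_smul`, `fderiv_const_smul`.
-/

noncomputable section

open MeasureTheory Set Function Filter Topology TopologicalSpace
open scoped ContDiff NNReal ENNReal InnerProductSpace RealInnerProductSpace

namespace Literature.Analysis.FluidPDE

open Literature.Analysis.FunctionSpaces

/-- Local notation for physical space `ℝ³ = EuclideanSpace ℝ (Fin 3)`. -/
local notation "ℝ³" => EuclideanSpace ℝ (Fin 3)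

/-! ### Proposition 1 from (71): the choice of `δ` -/

/-- **Ferrari's Proposition 1 in the periodic cylinder from (71)** (Ferrari 1993, Prop. 1 (30)
p. 286: for `Ω ⊂ ℝ³` bounded, simply connected, of class `C^{2+β}`, `v ∈ H³(Ω)` solving (22) with
data `φ ∈ H²(Ω)`, `χ = 0` — the instance `curl w = φ`, `div w = 0` in `Ω`, `w·n = 0` on `∂Ω` of
the Proof of Corollary —, `|v|_{W^{1,∞}(Ω)} ≤ C (1 + log⁺(‖φ‖_{H²(Ω)}/‖φ‖_{L^∞(Ω)})) ‖φ‖_{L^∞(Ω)}`;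
(72) p. 293: "the proof of the proposition is completed by setting
`δ = min{(|φ|_{L^∞}/‖φ‖_{H²(Ω)})², ε}`"; Shirota–Yanagisawa 1993, (15) with (17) p. 80 for general
topology, the harmonic components bounded by the energy). The hypothesis `hD` is **Ferrari's
global `δ`-estimate (71) p. 292 in the periodic cylinder, written out** (for `Ω`, `v`, `φ` as
above and every `δ ≤ ε(Ω)`, `|D_k v|_{L^∞(Ω)} ≤ (C₁ − C₂ log δ) |φ|_{L^∞(Ω)} + C δ^{1/2} ‖φ‖_{H²(Ω)}`,
`k = 1, 2, 3`, from the interior estimate (50) p. 289 and the boundary estimate (70) p. 292 —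
Green matrix (33)–(34), annulus integral (37), near field (48)–(49), (64)–(69) —;
Shirota–Yanagisawa 1993, (21) p. 81, the same splitting at scale `ρ`; rendering — all
`0 < δ ≤ 1`, `C (1 + log(1/δ))` for `C₁ − C₂ log δ`, upper bounds `N ≥ ‖curl v‖_{H²(cell)}`,
`e ≥ ‖v‖_{L²(cell)}`, `A ≥ sup_{r<1} |curl v|`, fields `C^∞` on the closed cylinder, `L`-periodic,
divergence free, tangential, adaptation caveat of the chain — as in the module docstring; it is
the body, unchanged, of the former named fact `Ferrari1993_periodicCylinderVorticityH2DeltaLogEstimate`,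
merged back by the split review). The conclusion is (30) in the periodic cylinder, written out —
the body of the former named fact `Ferrari1993_periodicCylinderVorticityH2LogEstimate`, merged back
earlier —: "+1" normalisation `C (e + 1 + (1 + log⁺ N) A)` of the printed scale-invariant bound
(implied by it, `A log⁺(N/A) ≤ A log⁺ N + e⁻¹`), same field hypotheses, sizes and caveat. Proof:
apply the `δ`-family with `δ = max(1, N)^{-2} ∈ (0, 1]`, for which `log(1/δ) = 2 log⁺ N` and
`δ^{1/2} N = N / max(1, N) ≤ 1`; hence `‖Dv(x)‖ ≤ C (e + (1 + 2 log⁺ N) A + 1) ≤ 2C (e + 1 + (1 + log⁺ N) A)`.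
"(31) from (30)" is `ShirotaYanagisawa1993_periodicCylinderLogDivCurlEstimate_of_vorticityH2`
(`Ferrari1993Prop1LogEstimate.lean`), whose hypothesis is this conclusion. [cite: Ferrari1993, Prop. 1 (30) p. 286 and (71)–(72) pp. 292–293]
[cite: ShirotaYanagisawa1993, (15) with (17) p. 80 and (21) p. 81] -/
theorem Ferrari1993_periodicCylinderVorticityH2LogEstimate_of_deltaFamily
    (hD : ∀ (L : ℝ) (_hL : 0 < L), ∃ C : ℝ≥0, ∀ (v : ℝ³ → ℝ³)
      (_hv : ContDiffOn ℝ ∞ v (closure (unitCylinder : Set ℝ³)))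
      (_hper : IsAxiallyPeriodic L v)
      (_hdiv : ∀ x ∈ (unitCylinder : Set ℝ³), VectorCalculus.divergence v x = 0)
      (_hslip : ∀ x ∈ frontier (unitCylinder : Set ℝ³), ⟪v x, eR x⟫ = 0) (N e A : ℝ≥0) (δ : ℝ)
      (_hδ : 0 < δ) (_hδ₁ : δ ≤ 1)
      (_hN : eSobolevDomainNorm 2 2 (cylinderCell L) volume (curl v) ≤ N)
      (_he : eLpNorm v 2 (volume.restrict (cylinderCell L : Set ℝ³)) ≤ e)
      (_hA : ∀ x ∈ (unitCylinder : Set ℝ³), ‖curl v x‖ ≤ A),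
      ∀ x ∈ (unitCylinder : Set ℝ³),
        ‖fderiv ℝ v x‖ ≤ C * (e + (1 + Real.log (1 / δ)) * A + δ ^ (1 / 2 : ℝ) * N)) :
    ∀ (L : ℝ) (_hL : 0 < L), ∃ C : ℝ≥0,
    ∀ (v : EuclideanSpace ℝ (Fin 3) → EuclideanSpace ℝ (Fin 3))
      (_hv : ContDiffOn ℝ ∞ v (closure (unitCylinder : Set (EuclideanSpace ℝ (Fin 3)))))
      (_hper : IsAxiallyPeriodic L v)
      (_hdiv : ∀ x ∈ (unitCylinder : Set (EuclideanSpace ℝ (Fin 3))),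
        VectorCalculus.divergence v x = 0)
      (_hslip : ∀ x ∈ frontier (unitCylinder : Set (EuclideanSpace ℝ (Fin 3))), ⟪v x, eR x⟫ = 0)
      (N e A : ℝ≥0)
      (_hN : eSobolevDomainNorm 2 2 (cylinderCell L) volume (curl v) ≤ N)
      (_he : eLpNorm v 2 (volume.restrict (cylinderCell L : Set (EuclideanSpace ℝ (Fin 3)))) ≤ e)
      (_hA : ∀ x ∈ (unitCylinder : Set (EuclideanSpace ℝ (Fin 3))), ‖curl v x‖ ≤ A),
    ∀ x ∈ (unitCylinder : Set (EuclideanSpace ℝ (Fin 3))),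
      ‖fderiv ℝ v x‖ ≤ C * (e + 1 + (1 + Real.posLog N) * A) := by
  intro L hL
  obtain ⟨C, hC⟩ := hD L hL
  refine ⟨2 * C, ?_⟩
  intro v hv hper hdiv hslip N e A hN he hA x hx
  -- the choice of `δ`
  set m : ℝ := max 1 (N : ℝ) with hm
  have hm1 : 1 ≤ m := le_max_left _ _
  have hm0 : 0 < m := one_pos.trans_le hm1
  have hNm : (N : ℝ) ≤ m := le_max_right _ _
  set δ : ℝ := (m ^ 2)⁻¹ with hδ
  have hδ0 : 0 < δ := by positivity
  have hδ1 : δ ≤ 1 := inv_le_one_of_one_le₀ (by nlinarith)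
  have hlog : Real.log (1 / δ) = 2 * Real.posLog (N : ℝ) := by
    rw [Real.posLog_eq_log_max_one N.coe_nonneg, ← hm, hδ, one_div, inv_inv, Real.log_pow]
    norm_num
  have hsqrt : δ ^ (1 / 2 : ℝ) = m⁻¹ := by
    rw [hδ, ← Real.sqrt_eq_rpow, Real.sqrt_inv, Real.sqrt_sq hm0.le]
  have key := hC v hv hper hdiv hslip N e A δ hδ0 hδ1 hN he hA x hx
  rw [hlog, hsqrt] at key
  -- bookkeeping
  have hfrac : m⁻¹ * (N : ℝ) ≤ 1 := by
    rw [inv_mul_le_iff₀ hm0, mul_one]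
    exact hNm
  have he0 : (0 : ℝ) ≤ e := e.coe_nonneg
  have hA0 : (0 : ℝ) ≤ A := A.coe_nonneg
  have hp0 : 0 ≤ Real.posLog (N : ℝ) := Real.posLog_nonneg
  have hsum : (e : ℝ) + (1 + 2 * Real.posLog (N : ℝ)) * A + m⁻¹ * (N : ℝ) ≤
      2 * (e + 1 + (1 + Real.posLog (N : ℝ)) * A) := by
    nlinarith [mul_nonneg hp0 hA0]
  calc ‖fderiv ℝ v x‖
      ≤ C * ((e : ℝ) + (1 + 2 * Real.posLog (N : ℝ)) * A + m⁻¹ * (N : ℝ)) := key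
    _ ≤ C * (2 * (e + 1 + (1 + Real.posLog (N : ℝ)) * A)) :=
        mul_le_mul_of_nonneg_left hsum C.coe_nonneg
    _ = ((2 * C : ℝ≥0) : ℝ) * (e + 1 + (1 + Real.posLog (N : ℝ)) * A) := by
        push_cast; ring

/-! ### (71) from Proposition 1: scaling -/

/-- **Scaling step.** If Ferrari's Proposition 1 holds in the periodic cylinder at period `L`
with constant `C` — `‖Dw(x)‖ ≤ C (e + 1 + (1 + log⁺ N) A)` on `{r < 1}` for every admissible `w`
and all upper bounds `N ≥ ‖curl w‖_{H²(cell)}`, `e ≥ ‖w‖_{L²(cell)}`, `A ≥ sup_{r<1} |curl w|` —,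
then for every admissible `v` with sizes bounded by `N, e, A` and every `c > 0`,
`‖Dv(x)‖ ≤ C (e + c⁻¹ + (1 + log⁺(c N)) A)` on `{r < 1}`: apply the bound to `w = c • v`, which
is admissible (the class is a cone) with `‖curl w‖_{H²(cell)} ≤ c N` (`curl w = c • curl v` on
the open cylinder, `curl_const_smul`, and `eSobolevDomainNorm_const_smul_le`),
`‖w‖_{L²(cell)} ≤ c e` (`eLpNorm_const_smul`), `|curl w| ≤ c A`, and divide
`‖Dw(x)‖ = c ‖Dv(x)‖` (`fderiv_const_smul`) by `c` (the pattern of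
`norm_fderiv_le_of_logDivCurlBound_smul`, `PeriodicCylinderLogDivCurl.lean`, with the vorticity
norm `‖curl v‖_{H²}` for `‖v‖_{H³}`). [folklore] -/
theorem norm_fderiv_le_of_vorticityH2LogBound_smul {L : ℝ} {C : ℝ≥0}
    (hC : ∀ (w : ℝ³ → ℝ³) (_hw : ContDiffOn ℝ ∞ w (closure (unitCylinder : Set ℝ³)))
      (_hper : IsAxiallyPeriodic L w)
      (_hdiv : ∀ x ∈ (unitCylinder : Set ℝ³), VectorCalculus.divergence w x = 0)
      (_hslip : ∀ x ∈ frontier (unitCylinder : Set ℝ³), ⟪w x, eR x⟫ = 0) (N e A : ℝ≥0)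
      (_hN : eSobolevDomainNorm 2 2 (cylinderCell L) volume (curl w) ≤ N)
      (_he : eLpNorm w 2 (volume.restrict (cylinderCell L : Set ℝ³)) ≤ e)
      (_hA : ∀ x ∈ (unitCylinder : Set ℝ³), ‖curl w x‖ ≤ A),
      ∀ x ∈ (unitCylinder : Set ℝ³), ‖fderiv ℝ w x‖ ≤ C * (e + 1 + (1 + Real.posLog N) * A))
    {v : ℝ³ → ℝ³} (hv : ContDiffOn ℝ ∞ v (closure (unitCylinder : Set ℝ³)))
    (hper : IsAxiallyPeriodic L v)
    (hdiv : ∀ x ∈ (unitCylinder : Set ℝ³), VectorCalculus.divergence v x = 0)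
    (hslip : ∀ x ∈ frontier (unitCylinder : Set ℝ³), ⟪v x, eR x⟫ = 0) {N e A : ℝ≥0}
    (hN : eSobolevDomainNorm 2 2 (cylinderCell L) volume (curl v) ≤ N)
    (he : eLpNorm v 2 (volume.restrict (cylinderCell L : Set ℝ³)) ≤ e)
    (hA : ∀ x ∈ (unitCylinder : Set ℝ³), ‖curl v x‖ ≤ A) {x : ℝ³}
    (hx : x ∈ (unitCylinder : Set ℝ³)) {c : ℝ} (hc : 0 < c) :
    ‖fderiv ℝ v x‖ ≤ C * (e + c⁻¹ + (1 + Real.posLog (c * N)) * A) := by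
  -- differentiability of `v` in the open cylinder
  have hvd : ∀ y ∈ (unitCylinder : Set ℝ³), DifferentiableAt ℝ v y := fun y hy =>
    (hv.differentiableOn (by simp) y (subset_closure hy)).differentiableAt
      (closure_unitCylinder_mem_nhds hy)
  -- the rescaled field is admissible
  set w : ℝ³ → ℝ³ := fun y => c • v y with hw
  have hwv : ContDiffOn ℝ ∞ w (closure (unitCylinder : Set ℝ³)) := hv.const_smul c
  have hwper : IsAxiallyPeriodic L w := fun y => by simp only [hw, hper y]
  have hwD : ∀ y ∈ (unitCylinder : Set ℝ³), fderiv ℝ w y = c • fderiv ℝ v y :=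
    fun y hy => fderiv_const_smul (hvd y hy) c
  have hwdiv : ∀ y ∈ (unitCylinder : Set ℝ³), VectorCalculus.divergence w y = 0 := by
    intro y hy
    unfold VectorCalculus.divergence
    rw [hwD y hy, ContinuousLinearMap.toLinearMap_smul, map_smul, smul_eq_mul]
    exact mul_eq_zero_of_right _ (hdiv y hy)
  have hwslip : ∀ y ∈ frontier (unitCylinder : Set ℝ³), ⟪w y, eR y⟫ = 0 := fun y hy => by
    simp only [hw, real_inner_smul_left, hslip y hy, mul_zero]
  -- the vorticity of the rescaled field on the open cylinder
  have hwcurl : ∀ y ∈ (unitCylinder : Set ℝ³), curl w y = c • curl v y := fun y hy =>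
    curl_const_smul (hvd y hy) c
  -- its sizes, with `c' = c` as a nonnegative real
  set c' : ℝ≥0 := ⟨c, hc.le⟩ with hc'
  have hcc : ((c' : ℝ≥0) : ℝ) = c := rfl
  have hcen : ‖c‖ₑ = (c' : ℝ≥0∞) := by
    rw [Real.enorm_eq_ofReal hc.le, ← hcc, ENNReal.ofReal_coe_nnreal]
  have hwN : eSobolevDomainNorm 2 2 (cylinderCell L) volume (curl w) ≤ (c' * N : ℝ≥0) := by
    have heq : EqOn (curl w) (c • curl v) (cylinderCell L) := fun y hy =>
      hwcurl y (cylinderCell_le_unitCylinder L hy)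
    calc eSobolevDomainNorm 2 2 (cylinderCell L) volume (curl w)
        = eSobolevDomainNorm 2 2 (cylinderCell L) volume (c • curl v) :=
          SobolevApprox.eSobolevDomainNorm_congr heq
      _ ≤ ‖c‖ₑ * eSobolevDomainNorm 2 2 (cylinderCell L) volume (curl v) :=
          eSobolevDomainNorm_const_smul_le c 2 (curl v)
      _ ≤ (c' : ℝ≥0∞) * N := by rw [hcen]; gcongr
      _ = ((c' * N : ℝ≥0) : ℝ≥0∞) := (ENNReal.coe_mul c' N).symm
  have hwe : eLpNorm w 2 (volume.restrict (cylinderCell L : Set ℝ³)) ≤ (c' * e : ℝ≥0) := by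
    calc eLpNorm w 2 (volume.restrict (cylinderCell L : Set ℝ³))
        = ‖c‖ₑ * eLpNorm v 2 (volume.restrict (cylinderCell L : Set ℝ³)) :=
          eLpNorm_const_smul c v _ _
      _ ≤ (c' : ℝ≥0∞) * e := by rw [hcen]; gcongr
      _ = ((c' * e : ℝ≥0) : ℝ≥0∞) := (ENNReal.coe_mul c' e).symm
  have hwA : ∀ y ∈ (unitCylinder : Set ℝ³), ‖curl w y‖ ≤ (c' * A : ℝ≥0) := by
    intro y hy
    rw [hwcurl y hy, norm_smul, Real.norm_of_nonneg hc.le, NNReal.coe_mul, hcc]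
    exact mul_le_mul_of_nonneg_left (hA y hy) hc.le
  -- the bound for `w` at `x`, divided by `c`
  have key := hC w hwv hwper hwdiv hwslip (c' * N) (c' * e) (c' * A) hwN hwe hwA x hx
  rw [hwD x hx, norm_smul, Real.norm_of_nonneg hc.le] at key
  push_cast at key
  rw [hcc] at key
  refine le_of_mul_le_mul_left (key.trans_eq ?_) hc
  field_simp

/-- **Ferrari's global `δ`-estimate (71) in the periodic cylinder from her Proposition 1, with the
same constant.** The hypothesis `hP` is Prop. 1 (30) p. 286 in the periodic cylinder, written out
(as in `Ferrari1993_periodicCylinderVorticityH2LogEstimate_of_deltaFamily`, character for character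
the hypothesis of `ShirotaYanagisawa1993_periodicCylinderLogDivCurlEstimate_of_vorticityH2`); the
conclusion is (71) p. 292 in the periodic cylinder, written out — the body, unchanged, of the
former named fact `Ferrari1993_periodicCylinderVorticityH2DeltaLogEstimate` (module docstring).
Proof by scaling (`norm_fderiv_le_of_vorticityH2LogBound_smul`): for `N > 0` take
`c = (δ^{1/2} N)⁻¹`, so that `c⁻¹ = δ^{1/2} N` and `log⁺(c N) = log⁺(δ^{-1/2}) = ½ log(1/δ)`
(`δ ≤ 1`); for `N = 0`, `‖Dv(x)‖ ≤ C (e + c⁻¹ + A)` for every `c > 0`, hence `≤ C (e + A)`. In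
print the implication runs the other way ((71) ⇒ (30) by (72)); this converse records that the
two renderings are equivalent, i.e. that (71) was not a smaller statement than its parent. [folklore] -/
theorem periodicCylinderVorticityH2DeltaLogEstimate_of_vorticityH2LogEstimate
    (hP : ∀ (L : ℝ) (_hL : 0 < L), ∃ C : ℝ≥0,
      ∀ (v : EuclideanSpace ℝ (Fin 3) → EuclideanSpace ℝ (Fin 3))
        (_hv : ContDiffOn ℝ ∞ v (closure (unitCylinder : Set (EuclideanSpace ℝ (Fin 3)))))
        (_hper : IsAxiallyPeriodic L v)
        (_hdiv : ∀ x ∈ (unitCylinder : Set (EuclideanSpace ℝ (Fin 3))),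
          VectorCalculus.divergence v x = 0)
        (_hslip : ∀ x ∈ frontier (unitCylinder : Set (EuclideanSpace ℝ (Fin 3))), ⟪v x, eR x⟫ = 0)
        (N e A : ℝ≥0)
        (_hN : eSobolevDomainNorm 2 2 (cylinderCell L) volume (curl v) ≤ N)
        (_he : eLpNorm v 2 (volume.restrict (cylinderCell L : Set (EuclideanSpace ℝ (Fin 3)))) ≤ e)
        (_hA : ∀ x ∈ (unitCylinder : Set (EuclideanSpace ℝ (Fin 3))), ‖curl v x‖ ≤ A),
      ∀ x ∈ (unitCylinder : Set (EuclideanSpace ℝ (Fin 3))),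
        ‖fderiv ℝ v x‖ ≤ C * (e + 1 + (1 + Real.posLog N) * A)) :
    ∀ (L : ℝ) (_hL : 0 < L), ∃ C : ℝ≥0, ∀ (v : ℝ³ → ℝ³)
      (_hv : ContDiffOn ℝ ∞ v (closure (unitCylinder : Set ℝ³)))
      (_hper : IsAxiallyPeriodic L v)
      (_hdiv : ∀ x ∈ (unitCylinder : Set ℝ³), VectorCalculus.divergence v x = 0)
      (_hslip : ∀ x ∈ frontier (unitCylinder : Set ℝ³), ⟪v x, eR x⟫ = 0) (N e A : ℝ≥0) (δ : ℝ)
      (_hδ : 0 < δ) (_hδ₁ : δ ≤ 1)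
      (_hN : eSobolevDomainNorm 2 2 (cylinderCell L) volume (curl v) ≤ N)
      (_he : eLpNorm v 2 (volume.restrict (cylinderCell L : Set ℝ³)) ≤ e)
      (_hA : ∀ x ∈ (unitCylinder : Set ℝ³), ‖curl v x‖ ≤ A),
      ∀ x ∈ (unitCylinder : Set ℝ³),
        ‖fderiv ℝ v x‖ ≤ C * (e + (1 + Real.log (1 / δ)) * A + δ ^ (1 / 2 : ℝ) * N) := by
  intro L hL
  obtain ⟨C, hC⟩ := hP L hL
  refine ⟨C, ?_⟩
  intro v hv hper hdiv hslip N e A δ hδ hδ₁ hN he hA x hx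
  have hA0 : (0 : ℝ) ≤ A := A.coe_nonneg
  have hN0 : (0 : ℝ) ≤ N := N.coe_nonneg
  have hC0 : (0 : ℝ) ≤ C := C.coe_nonneg
  have hlog : 0 ≤ Real.log (1 / δ) := Real.log_nonneg ((one_le_div hδ).2 hδ₁)
  have hrp : 0 < δ ^ (1 / 2 : ℝ) := Real.rpow_pos_of_pos hδ _
  rcases eq_or_ne N 0 with rfl | hN'
  · -- `N = 0`: let the scaling parameter tend to infinity
    have hlim : ‖fderiv ℝ v x‖ ≤ C * (e + A) := by
      refine le_of_forall_pos_le_add fun ε hε => ?_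
      have hcpos : (0 : ℝ) < (C + 1) / ε := by positivity
      have key := norm_fderiv_le_of_vorticityH2LogBound_smul hC hv hper hdiv hslip hN he hA hx hcpos
      rw [NNReal.coe_zero, mul_zero, Real.posLog_zero, add_zero, one_mul, inv_div] at key
      refine key.trans ?_
      have : (C : ℝ) * (ε / (C + 1)) ≤ ε := by
        rw [mul_div_assoc']
        exact div_le_of_le_mul₀ (by positivity) hε.le (by nlinarith)
      nlinarith
    refine hlim.trans (mul_le_mul_of_nonneg_left ?_ hC0)
    rw [NNReal.coe_zero, mul_zero, add_zero]
    nlinarith [mul_nonneg hlog hA0]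
  · -- `N > 0`: scaling parameter `c = (δ^{1/2} N)⁻¹`
    have hNpos : (0 : ℝ) < N := lt_of_le_of_ne hN0 (by exact_mod_cast hN'.symm)
    have hcpos : (0 : ℝ) < (δ ^ (1 / 2 : ℝ) * N)⁻¹ := by positivity
    have key := norm_fderiv_le_of_vorticityH2LogBound_smul hC hv hper hdiv hslip hN he hA hx hcpos
    rw [inv_inv] at key
    -- `c N = δ^{-1/2}` and `log⁺ δ^{-1/2} = ½ log (1/δ)`
    have hcN : (δ ^ (1 / 2 : ℝ) * N)⁻¹ * (N : ℝ) = (δ ^ (1 / 2 : ℝ))⁻¹ := by field_simp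
    have hplog : Real.posLog ((δ ^ (1 / 2 : ℝ))⁻¹) = (1 / 2) * Real.log (1 / δ) := by
      have h1 : 1 ≤ (δ ^ (1 / 2 : ℝ))⁻¹ := by
        rw [one_le_inv₀ hrp]
        exact Real.rpow_le_one hδ.le hδ₁ (by norm_num)
      rw [Real.posLog_eq_log (by rwa [abs_of_pos (inv_pos.2 hrp)]), Real.log_inv,
        Real.log_rpow hδ, one_div δ, Real.log_inv]
      ring
    rw [hcN, hplog] at key
    refine key.trans (mul_le_mul_of_nonneg_left ?_ hC0)
    nlinarith [mul_nonneg hlog hA0, mul_nonneg hrp.le hN0]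

/-- **Ferrari's Proposition 1 and her global `δ`-estimate (71) are equivalent in the periodic
cylinder** (the review finding of the module docstring: (30) p. 286 and (71) p. 292, as rendered in
this chain, imply each other — by scaling with the same constant, and by the printed choice of the
radius (72) p. 293 with twice the constant). [folklore] -/
theorem periodicCylinderVorticityH2LogEstimate_iff_deltaLogEstimate :
    (∀ (L : ℝ) (_hL : 0 < L), ∃ C : ℝ≥0,
      ∀ (v : EuclideanSpace ℝ (Fin 3) → EuclideanSpace ℝ (Fin 3))
        (_hv : ContDiffOn ℝ ∞ v (closure (unitCylinder : Set (EuclideanSpace ℝ (Fin 3)))))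
        (_hper : IsAxiallyPeriodic L v)
        (_hdiv : ∀ x ∈ (unitCylinder : Set (EuclideanSpace ℝ (Fin 3))),
          VectorCalculus.divergence v x = 0)
        (_hslip : ∀ x ∈ frontier (unitCylinder : Set (EuclideanSpace ℝ (Fin 3))), ⟪v x, eR x⟫ = 0)
        (N e A : ℝ≥0)
        (_hN : eSobolevDomainNorm 2 2 (cylinderCell L) volume (curl v) ≤ N)
        (_he : eLpNorm v 2 (volume.restrict (cylinderCell L : Set (EuclideanSpace ℝ (Fin 3)))) ≤ e)
        (_hA : ∀ x ∈ (unitCylinder : Set (EuclideanSpace ℝ (Fin 3))), ‖curl v x‖ ≤ A),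
      ∀ x ∈ (unitCylinder : Set (EuclideanSpace ℝ (Fin 3))),
        ‖fderiv ℝ v x‖ ≤ C * (e + 1 + (1 + Real.posLog N) * A)) ↔
    ∀ (L : ℝ) (_hL : 0 < L), ∃ C : ℝ≥0, ∀ (v : ℝ³ → ℝ³)
      (_hv : ContDiffOn ℝ ∞ v (closure (unitCylinder : Set ℝ³)))
      (_hper : IsAxiallyPeriodic L v)
      (_hdiv : ∀ x ∈ (unitCylinder : Set ℝ³), VectorCalculus.divergence v x = 0)
      (_hslip : ∀ x ∈ frontier (unitCylinder : Set ℝ³), ⟪v x, eR x⟫ = 0) (N e A : ℝ≥0) (δ : ℝ)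
      (_hδ : 0 < δ) (_hδ₁ : δ ≤ 1)
      (_hN : eSobolevDomainNorm 2 2 (cylinderCell L) volume (curl v) ≤ N)
      (_he : eLpNorm v 2 (volume.restrict (cylinderCell L : Set ℝ³)) ≤ e)
      (_hA : ∀ x ∈ (unitCylinder : Set ℝ³), ‖curl v x‖ ≤ A),
      ∀ x ∈ (unitCylinder : Set ℝ³),
        ‖fderiv ℝ v x‖ ≤ C * (e + (1 + Real.log (1 / δ)) * A + δ ^ (1 / 2 : ℝ) * N) :=
  ⟨periodicCylinderVorticityH2DeltaLogEstimate_of_vorticityH2LogEstimate,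
    Ferrari1993_periodicCylinderVorticityH2LogEstimate_of_deltaFamily⟩

/-! ### What (71) implies: the Shirota–Yanagisawa `δ`-family and the chain's remaining leaf -/

/-- **The Shirota–Yanagisawa form of the `δ`-family from Ferrari's (71)** (Ferrari 1993, Proof
of Corollary p. 286, "(31) follows easily from (30)": the vorticity loses one Sobolev order
against the velocity): with `‖curl v‖_{H²(cell)} ≤ C_S ‖v‖_{H³(cell)} ≤ C_S n`
(`exists_eSobolevDomainNorm_curl_le`) the near-field term `δ^{1/2} C_S n` of (71) is at most
`max(1, C_S)` times `δ^{1/2} n`; the constant becomes `C max(1, C_S)`. The hypothesis `hD` is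
(71) in the periodic cylinder, written out (the body of the former named fact
`Ferrari1993_periodicCylinderVorticityH2DeltaLogEstimate`, module docstring); the conclusion — for
`L > 0` a constant `C` with `‖Dv(x)‖ ≤ C (e + (1 + log(1/δ)) A + δ^{1/2} n)` on `{r < 1}` for all
admissible `v`, all `0 < δ ≤ 1` and all upper bounds `n ≥ ‖v‖_{H³(cell)}`, `e ≥ ‖v‖_{L²(cell)}`,
`A ≥ sup_{r<1} |curl v|` — is the body, unchanged and written out, of the former named fact
`ShirotaYanagisawa1993_periodicCylinderDeltaLogDivCurlEstimate` (merged back by its split review;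
`PeriodicCylinderLogDivCurl.lean` proves it equivalent to
`ShirotaYanagisawa1993_periodicCylinderLogDivCurlEstimate` and keeps
`ShirotaYanagisawa1993_periodicCylinderLogDivCurlEstimate_of_deltaFamily`, whose written-out
hypothesis is this conclusion). [cite: Ferrari1993, (71) p. 292 and Proof of Corollary p. 286]
[cite: ShirotaYanagisawa1993, (21) p. 81] -/
theorem ShirotaYanagisawa1993_periodicCylinderDeltaLogDivCurlEstimate_of_vorticityH2DeltaFamily
    (hD : ∀ (L : ℝ) (_hL : 0 < L), ∃ C : ℝ≥0, ∀ (v : ℝ³ → ℝ³)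
      (_hv : ContDiffOn ℝ ∞ v (closure (unitCylinder : Set ℝ³)))
      (_hper : IsAxiallyPeriodic L v)
      (_hdiv : ∀ x ∈ (unitCylinder : Set ℝ³), VectorCalculus.divergence v x = 0)
      (_hslip : ∀ x ∈ frontier (unitCylinder : Set ℝ³), ⟪v x, eR x⟫ = 0) (N e A : ℝ≥0) (δ : ℝ)
      (_hδ : 0 < δ) (_hδ₁ : δ ≤ 1)
      (_hN : eSobolevDomainNorm 2 2 (cylinderCell L) volume (curl v) ≤ N)
      (_he : eLpNorm v 2 (volume.restrict (cylinderCell L : Set ℝ³)) ≤ e)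
      (_hA : ∀ x ∈ (unitCylinder : Set ℝ³), ‖curl v x‖ ≤ A),
      ∀ x ∈ (unitCylinder : Set ℝ³),
        ‖fderiv ℝ v x‖ ≤ C * (e + (1 + Real.log (1 / δ)) * A + δ ^ (1 / 2 : ℝ) * N)) :
    ∀ (L : ℝ) (_hL : 0 < L), ∃ C : ℝ≥0, ∀ (v : ℝ³ → ℝ³)
      (_hv : ContDiffOn ℝ ∞ v (closure (unitCylinder : Set ℝ³)))
      (_hper : IsAxiallyPeriodic L v)
      (_hdiv : ∀ x ∈ (unitCylinder : Set ℝ³), VectorCalculus.divergence v x = 0)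
      (_hslip : ∀ x ∈ frontier (unitCylinder : Set ℝ³), ⟪v x, eR x⟫ = 0) (n e A : ℝ≥0) (δ : ℝ)
      (_hδ : 0 < δ) (_hδ₁ : δ ≤ 1)
      (_hn : eSobolevDomainNorm 3 2 (cylinderCell L) volume v ≤ n)
      (_he : eLpNorm v 2 (volume.restrict (cylinderCell L : Set ℝ³)) ≤ e)
      (_hA : ∀ x ∈ (unitCylinder : Set ℝ³), ‖curl v x‖ ≤ A),
      ∀ x ∈ (unitCylinder : Set ℝ³),
        ‖fderiv ℝ v x‖ ≤ C * (e + (1 + Real.log (1 / δ)) * A + δ ^ (1 / 2 : ℝ) * n) := by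
  intro L hL
  obtain ⟨C, hC⟩ := hD L hL
  obtain ⟨C_S, hS⟩ := exists_eSobolevDomainNorm_curl_le L
  refine ⟨C * max 1 C_S, ?_⟩
  intro v hv hper hdiv hslip n e A δ hδ hδ₁ hn he hA x hx
  have hN : eSobolevDomainNorm 2 2 (cylinderCell L) volume (curl v) ≤ (C_S * n : ℝ≥0) := by
    push_cast
    exact (hS v hv 2).trans (mul_le_mul' le_rfl hn)
  have key := hC v hv hper hdiv hslip (C_S * n) e A δ hδ hδ₁ hN he hA x hx
  refine key.trans ?_
  have hM1 : (1 : ℝ) ≤ max 1 (C_S : ℝ) := le_max_left _ _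
  have hMS : (C_S : ℝ) ≤ max 1 (C_S : ℝ) := le_max_right _ _
  have he0 : (0 : ℝ) ≤ e := e.coe_nonneg
  have hA0 : (0 : ℝ) ≤ A := A.coe_nonneg
  have hn0 : (0 : ℝ) ≤ n := n.coe_nonneg
  have hC0 : (0 : ℝ) ≤ C := C.coe_nonneg
  have hlog : 0 ≤ Real.log (1 / δ) := Real.log_nonneg ((one_le_div hδ).2 hδ₁)
  have hrp : 0 ≤ δ ^ (1 / 2 : ℝ) := Real.rpow_nonneg hδ.le _
  have h1 : (e : ℝ) ≤ max 1 (C_S : ℝ) * e := le_mul_of_one_le_left he0 hM1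
  have h2 : (1 + Real.log (1 / δ)) * A ≤ max 1 (C_S : ℝ) * ((1 + Real.log (1 / δ)) * A) :=
    le_mul_of_one_le_left (mul_nonneg (by linarith) hA0) hM1
  have h3 : δ ^ (1 / 2 : ℝ) * ((C_S : ℝ) * n) ≤ max 1 (C_S : ℝ) * (δ ^ (1 / 2 : ℝ) * n) := by
    calc δ ^ (1 / 2 : ℝ) * ((C_S : ℝ) * n) = (C_S : ℝ) * (δ ^ (1 / 2 : ℝ) * n) := by ring
      _ ≤ max 1 (C_S : ℝ) * (δ ^ (1 / 2 : ℝ) * n) :=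
          mul_le_mul_of_nonneg_right hMS (mul_nonneg hrp hn0)
  push_cast
  calc (C : ℝ) * (e + (1 + Real.log (1 / δ)) * A + δ ^ (1 / 2 : ℝ) * ((C_S : ℝ) * n))
      ≤ C * (max 1 (C_S : ℝ) * e + max 1 (C_S : ℝ) * ((1 + Real.log (1 / δ)) * A) +
          max 1 (C_S : ℝ) * (δ ^ (1 / 2 : ℝ) * n)) :=
        mul_le_mul_of_nonneg_left (add_le_add (add_le_add h1 h2) h3) hC0
    _ = C * max 1 (C_S : ℝ) * (e + (1 + Real.log (1 / δ)) * A + δ ^ (1 / 2 : ℝ) * n) := by ring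

/-- **The chain's remaining leaf from Ferrari's (71) alone**:
`ShirotaYanagisawa1993_periodicCylinderLogDivCurlEstimate` (Cor. 1 (31) p. 286 read for one field)
from (71) written out, through the choice of `δ` (72)
(`Ferrari1993_periodicCylinderVorticityH2LogEstimate_of_deltaFamily`) and "(31) from (30)"
(`ShirotaYanagisawa1993_periodicCylinderLogDivCurlEstimate_of_vorticityH2`); equivalently through
`ShirotaYanagisawa1993_periodicCylinderDeltaLogDivCurlEstimate_of_vorticityH2DeltaFamily` and
`ShirotaYanagisawa1993_periodicCylinderLogDivCurlEstimate_of_deltaFamily`. Formerly stated on the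
named fact in `Ferrari1993ContinuationLeaves.lean` (same name). [cite: Ferrari1993, Prop. 1 (30)–(31) p. 286 with (71)–(72) pp. 292–293] -/
theorem ShirotaYanagisawa1993_periodicCylinderLogDivCurlEstimate_of_deltaLogEstimate
    (hD : ∀ (L : ℝ) (_hL : 0 < L), ∃ C : ℝ≥0, ∀ (v : ℝ³ → ℝ³)
      (_hv : ContDiffOn ℝ ∞ v (closure (unitCylinder : Set ℝ³)))
      (_hper : IsAxiallyPeriodic L v)
      (_hdiv : ∀ x ∈ (unitCylinder : Set ℝ³), VectorCalculus.divergence v x = 0)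
      (_hslip : ∀ x ∈ frontier (unitCylinder : Set ℝ³), ⟪v x, eR x⟫ = 0) (N e A : ℝ≥0) (δ : ℝ)
      (_hδ : 0 < δ) (_hδ₁ : δ ≤ 1)
      (_hN : eSobolevDomainNorm 2 2 (cylinderCell L) volume (curl v) ≤ N)
      (_he : eLpNorm v 2 (volume.restrict (cylinderCell L : Set ℝ³)) ≤ e)
      (_hA : ∀ x ∈ (unitCylinder : Set ℝ³), ‖curl v x‖ ≤ A),
      ∀ x ∈ (unitCylinder : Set ℝ³),
        ‖fderiv ℝ v x‖ ≤ C * (e + (1 + Real.log (1 / δ)) * A + δ ^ (1 / 2 : ℝ) * N)) :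
    ShirotaYanagisawa1993_periodicCylinderLogDivCurlEstimate :=
  ShirotaYanagisawa1993_periodicCylinderLogDivCurlEstimate_of_vorticityH2
    (Ferrari1993_periodicCylinderVorticityH2LogEstimate_of_deltaFamily hD)

end Literature.Analysis.FluidPDE
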